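import Mathlib
import Summits.ValiantsHypothesis.ValiantsHypothesis.Theses.FreeSubtorus
import Summits.ValiantsHypothesis.ValiantsHypothesis.Theorems.FreeSubtorusSubtorusCovering
import Summits.ValiantsHypothesis.ValiantsHypothesis.Cruxes.OrbitDimensionBound.Lines.DegreeLadder
import Summits.ValiantsHypothesis.ValiantsHypothesis.Cruxes.OrbitDimensionBound.Lines.MultipleLadder
import Literature.Computability.AlgebraicComplexity.EquivariantDC
import Summits.ValiantsHypothesis.ValiantsHypothesis.Theorems.FreeSubtorusOrbitDimensionBoundStubCofactorShape
import Summits.ValiantsHypothesis.ValiantsHypothesis.Theorems.FreeSubtorusOrbitDimensionBoundStubAbsorbingSacrifice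
import Summits.ValiantsHypothesis.ValiantsHypothesis.Theorems.FreeSubtorusOrbitDimensionBoundStubPerInvariantTorusBound

/-!
# Line `affine_multiple` — skeleton for the rung `Multiple.AffineMultipleShadow` (ideal dial, absorbing sacrifice)

Crux advanced: `OrbitDimensionBound` (stmt-ValiantsHypothesis-16133) of `route-ValiantsHypothesis-FreeSubtorus`; floor
`SubtorusCovering` (PROVED, `subtorusCovering_proof`); rung `Multiple.AffineMultipleShadow` / numeric
`Multiple.AffineMultipleCovering = MultipleCovering 1` (`Lines/MultipleLadder.lean`, sorry-free: `δ = 0` IS the floor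
up to rescaling a constant cofactor, `S → MultipleShadow δ` PROVED for every `δ` via Kaltofen-free exact division).

THE LINE (three registered stubs, composition kernel-checked).  Object: a `T_Λ`-equivariant (exact constant lifts)
affine representation `B` (size `m`) of a non-zero multiple `per_n · q`, `deg q ≤ 1`, `Λ` admissible with `r`
generators.  The floor's engine (pair sacrifice ⇒ full two-sided torus ⇒ `stub_torusBound`) breaks because the
substitution may annihilate `q` and because the terminal weight count needs `det = per` on the nose (von zur Gathen
regularity, injective members on every permutation graph).  The line replaces it by an ABSORBING sacrifice:
1. `stub_cofactorShape` (M) — FORCED SEMI-INVARIANCE.  A lift of `γ ∈ T_Λ` gives `det B(γ·x) = c_γ det B(x)`, and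
   `per_n(γ·x) = χ(γ) per_n(x)`; `ℂ[x]` is a domain, so `q(γ·x) = c'_γ q(x)`: the cofactor is a `T_Λ`-semi-invariant.
   Admissibility puts every homothety `x ↦ t·x` in `T_Λ`; comparing the constant and the linear part of `q(t·x) = c'(t)
   q(x)` at `t = 2` shows that an affine cofactor is either a non-zero CONSTANT or a LINEAR FORM (homogeneous, degree 1).
2. `stub_absorbingSacrifice` (L, load-bearing) — PAIR SACRIFICE WITH ONE PINNED COORDINATE.  Take the floor's maximum
   independent matching `M` (`s ≤ r` pairs whose differences `a_ι - b_κ` span all columns of `Λ`, or `n ≤ s + 2`).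
   Substitute generic NON-ZERO constants `t_j` on the sacrificed diagonal (the floor used `1`): `per_n ↦ (∏ t) per_{n'}`
   and `q ↦ Σ_{M ∩ supp q} q_p t_p + q|_{free}`.  (a) If `supp q` meets the free block in a position `p`, then `p` is
   unique (two free positions of equal `T_Λ`-weight would force `d'_k e'_l = d'_{k'} e'_{l'}` on the whole free torus,
   contradicting the torus extension) and is sacrificed as ONE EXTRA pair (`t ≤ r + 1` pairs in all); (b) if `supp q`
   meets the diagonal of `M`, genericity of `t` makes the new cofactor a non-zero constant; (c) otherwise a position
   `(ι_j, l)` of `supp q` with `l` free (or its transpose, or `(ι_j, κ_{j'})` reduced to this by re-covering) is either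
   re-matched (`M - (ι_j,κ_j) + (ι_j,l)`, or `M - (ι_j,κ_j) + (k'',l'') + (ι_j,l)`, spanning iff `[a_{ι_j}] ≠ [b_l]`
   resp. `[a_{k''}] ≠ [b_{l''}]` in `W / span(M ∖ j) ≅ ℚ`), or — when all of these fail, which forces `[a_k] = [b_{l'}] =
   [b_{κ_j}] = [b_l] - 1` for all free `k, l' ≠ l` — the variable `x_{(ι_j,l)}` is replaced by a generic CONSTANT `u₀`
   (allowed: with the free-rows × sacrificed-columns block zero, entries of sacrificed rows in free columns never enter
   `per`), which pins ONE coordinate of the torus extension (`d_{ι_j} e_l = 1`) and leaves exactly the PER-INVARIANT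
   subtorus `T¹ = {∏ d' ∏ e' = 1}` of the free block (`torusGen n' 1 𝟙`, the first non-admissible lattice datum, cf.
   `NoMinorLadder.noInvariantMinor_ones`).  In every branch the semi-invariant new cofactor is a non-zero constant,
   rescaled away (`Multiple.exists_rescale`), and the full free torus contains `T¹`.  Output: `n = n' + t`, `t ≤ r + 1`,
   and either `n' ≤ 2` or a `T¹`-equivariant affine representation of `per_{n'}` of the same size `m`.
3. `stub_perInvariantTorusBound` (L) — TERMINAL BOUND ON THE PER-INVARIANT TORUS.  For `n ≥ 3` a `T¹`-equivariant
   (exact lifts) affine representation of `per_n` has `2^{n-1} ≤ m` (expected truth `2^n - 1`, as for the full torus: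
   the weight engine of `BorderApolarityToricWitnessObstructionQP.stub_torusBound` run with the generic element
   `d = (p_1,…,p_{n-1}, 1/∏p)`, `e = (q_1,…,q_{n-1}, 1/∏q)` of `T¹`, whose level-`s` weights are still pairwise distinct;
   regularity holds since `det = per_n`).  Only the half form is claimed; the ladder's loss factor `δ + 1 = 2` pays for
   it and for the extra pair of 2(a).
Composition `affineMultipleCovering_of`: constant cofactor ⇒ rescale ⇒ the FLOOR by name; linear cofactor ⇒ stub 2 ⇒
(`n' ≤ 2`: `m ≥ deg (per_n · q) = n + 1` and `2^r ≥ 2^{n-3}`) or (stub 3: `2^{n'-1} ≤ m`, `n' + r ≥ n - 1`); in all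
cases `C(n,⌊n/2⌋) ≤ 2^{n-1} ≤ 2 · m · 2^r`.  Then `AffineMultipleShadow_of` via the ladder's
`affineMultipleShadow_of_affineMultipleCovering`, and `summit_of_stubs : OrbitMultipleBound 1 → stubs → VH` via
`closes_affineMultiple` (also from the host crux `OrbitDimensionBound`, `closes_of_orbitDimensionBound`).

Disproof used: `Cruxes/OrbitDimensionBound/Disproof.lean` concerns the symmetrisation crux itself (`∃ B`-targets, in-place
refutations `orbitDimensionBound_false_without_repHyp`, `not_orbitDimensionBoundInPlace`, `twistedGrenet_no_homothety_lift`);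
this line proves a lower bound for GIVEN equivariant data and never claims a representation can be symmetrised, so it
instantiates none of the refuted strengthenings; the relaxed target `OrbitMultipleBound 1` is again an `∃ B`-statement.
Negatives index (`ledger negatives --problem ValiantsHypothesis`): no refuted statement concerns multiples of the
permanent, padded permanents with symmetry, or the per-invariant torus.
-/

open Matrix MvPolynomial Finset
open Literature.Computability.AlgebraicComplexity
open Summit.ValiantsHypothesis.ValiantsHypothesis.Cruxes.OrbitDimensionBound.Degree
open Summit.ValiantsHypothesis.ValiantsHypothesis.Cruxes.OrbitDimensionBound.Multiple
open Summit.ValiantsHypothesis.ValiantsHypothesis.Theorems.FreeSubtorusSubtorusCovering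

-- the mandated summit-side namespace repeats a component by design (single-problem summit)
set_option linter.dupNamespace false
set_option linter.unusedVariables false

noncomputable section

namespace Summit.ValiantsHypothesis.ValiantsHypothesis.Cruxes.OrbitDimensionBound.Multiple.Line

/-! ## §1 Statements of the stubs -/

/-- Statement of stub 1 (`stub_cofactorShape`, M): the cofactor of an equivariantly represented multiple `per_n · q`
is FORCED to be a `T_Λ`-semi-invariant (domain argument), and the homotheties inside an admissible `T_Λ` split an
affine cofactor: it is a non-zero constant or a linear form. [cite: LandsbergRessayre2017, §3, §6] -/
def Stmt.stub_cofactorShape : Prop :=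
  ∀ (n m r : ℕ) (Λ : Fin r → (Fin n ⊕ Fin n) → ℤ) (B : Matrix (Fin m) (Fin m) (MvPolynomial (Fin n × Fin n) ℂ))
    (q : MvPolynomial (Fin n × Fin n) ℂ),
    1 ≤ n → Admissible n r Λ → q ≠ 0 → q.totalDegree ≤ 1 →
    IsEquivariantDetRepr (Subgroup.closure (torusGen n r Λ)) (perPoly (Fin n) ℂ * q) B →
    (∃ c : ℂ, c ≠ 0 ∧ q = C c) ∨ q.IsHomogeneous 1

/-- Statement of stub 2 (`stub_absorbingSacrifice`, L — load-bearing): the floor's pair sacrifice made `q`-ABSORBING —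
generic non-zero diagonal constants, at most ONE extra pair, and in the rigid configuration one pinned off-diagonal
constant, which costs exactly the per-scaling direction of the free torus: the output is equivariant under the
per-invariant torus `T¹ = torusGen n' 1 𝟙` of the free block (contained in the full torus in the unpinned branches).
[cite: LandsbergRessayre2017, Thm. 2.8, §6] -/
def Stmt.stub_absorbingSacrifice : Prop :=
  ∀ (n m r : ℕ) (Λ : Fin r → (Fin n ⊕ Fin n) → ℤ) (B : Matrix (Fin m) (Fin m) (MvPolynomial (Fin n × Fin n) ℂ))
    (q : MvPolynomial (Fin n × Fin n) ℂ),
    3 ≤ n → Admissible n r Λ → q ≠ 0 → q.IsHomogeneous 1 →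
    IsEquivariantDetRepr (Subgroup.closure (torusGen n r Λ)) (perPoly (Fin n) ℂ * q) B →
    ∃ n' t : ℕ, n = n' + t ∧ t ≤ r + 1 ∧
      (n' ≤ 2 ∨ ∃ B' : Matrix (Fin m) (Fin m) (MvPolynomial (Fin n' × Fin n') ℂ),
        IsEquivariantDetRepr (Subgroup.closure (torusGen n' 1 (fun _ _ => 1))) (perPoly (Fin n') ℂ) B')

/-- Statement of stub 3 (`stub_perInvariantTorusBound`, L): the terminal bound for the PER-INVARIANT torus
`T¹ = {diag(d_k e_l) : ∏ d ∏ e = 1}` (exact lifts), in the half form `2^{n-1} ≤ m` (expected: `2^n - 1`, by the weight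
engine of the full-torus theorem with a generic element of `T¹`). [cite: LandsbergRessayre2017, Thm. 2.8, §6]
[cite: Vonzurgathen1987, Thm. 3.1] -/
def Stmt.stub_perInvariantTorusBound : Prop :=
  ∀ (n m : ℕ) (B : Matrix (Fin m) (Fin m) (MvPolynomial (Fin n × Fin n) ℂ)), 3 ≤ n →
    IsEquivariantDetRepr (Subgroup.closure (torusGen n 1 (fun _ _ => 1))) (perPoly (Fin n) ℂ) B →
    2 ^ (n - 1) ≤ m

/-! ## §2 The registered stubs -/

/-- Stub 1: forced semi-invariance of the cofactor; homotheties split constant from linear.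
LANDED: `Theorems/FreeSubtorusOrbitDimensionBoundStubCofactorShape.lean` (p567288; val-lit-p8 g8), statement inlined —
closed here by name (wired 2026-08-28, val-width-16133-w1 g2). [cite: LandsbergRessayre2017, §3, §6] -/
theorem stub_cofactorShape : Stmt.stub_cofactorShape :=
  Summit.ValiantsHypothesis.ValiantsHypothesis.Theorems.FreeSubtorusOrbitDimensionBound.stub_cofactorShape

/-- Stub 2: the `q`-absorbing pair sacrifice with one pinned coordinate (load-bearing).
LANDED: `Theorems/FreeSubtorusOrbitDimensionBoundStubAbsorbingSacrifice.lean` (p591335; val-lit-p6 g11, over the helper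
files `…StubAbsorbingSacrifice{Pin,Lifts,Extension,RigidCoefficients,Rematch,FinalMatchingPrelim,FinalMatching,
FinalMatchingRematch,CofactorWeights,RelabelGeneral,TerminalTools,Terminal}.lean` of val-lit-p4 g9 / p6 g11), statement
inlined — closed here by name (wired 2026-08-28, val-width-16133-w1 g2). [cite: LandsbergRessayre2017, Thm. 2.8, §6] -/
theorem stub_absorbingSacrifice : Stmt.stub_absorbingSacrifice :=
  Summit.ValiantsHypothesis.ValiantsHypothesis.Theorems.FreeSubtorusOrbitDimensionBound.stub_absorbingSacrifice

/-- Stub 3: the terminal weight count on the per-invariant torus `T¹`.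
LANDED: `Theorems/FreeSubtorusOrbitDimensionBoundStubPerInvariantTorusBound.lean` (p570355, in the full form `2^n − 1 ≤ m`;
helpers p567563 / p569356; val-lit-p8 g8), statement inlined — closed here by name (wired 2026-08-28, val-width-16133-w1 g2).
[cite: LandsbergRessayre2017, Thm. 2.8, §6] [cite: Vonzurgathen1987, Thm. 3.1] -/
theorem stub_perInvariantTorusBound : Stmt.stub_perInvariantTorusBound :=
  Summit.ValiantsHypothesis.ValiantsHypothesis.Theorems.FreeSubtorusOrbitDimensionBound.stub_perInvariantTorusBound

/-! ## §3 Composition (kernel-checked, no sorry below this line) -/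

/-- Arithmetic of the degenerate branch: `n ≥ 3`, `C(n,⌊n/2⌋) ≤ 2^{n-1} = 4 · 2^{n-3} ≤ 2 (n+1) 2^{n-3}`. [folklore] -/
theorem choose_middle_le_small {n m r : ℕ} (hn : 3 ≤ n) (hm : n + 1 ≤ m) (hr : n ≤ r + 3) :
    n.choose (n / 2) ≤ (1 + 1) * (m * 2 ^ r) := by
  have h1 : n.choose (n / 2) ≤ 2 ^ (n - 1) := choose_middle_le_two_pow_pred n (by omega)
  have h2 : 2 ^ (n - 1) = 4 * 2 ^ (n - 3) := by
    rw [show n - 1 = (n - 3) + 2 by omega, pow_add]; ring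
  have h3 : 2 ^ (n - 3) ≤ 2 ^ r := Nat.pow_le_pow_right (by norm_num) (by omega)
  calc n.choose (n / 2) ≤ 4 * 2 ^ (n - 3) := h2 ▸ h1
    _ ≤ (1 + 1) * ((n + 1) * 2 ^ (n - 3)) := by nlinarith [Nat.one_le_two_pow (n := n - 3)]
    _ ≤ (1 + 1) * (m * 2 ^ r) := by gcongr

/-- Arithmetic of the main branch: `2^{n'-1} ≤ m`, `n = n' + t`, `t ≤ r + 1`, so
`C(n,⌊n/2⌋) ≤ 2^{n-1} ≤ 2^{(n'-1) + r + 1} = 2 · 2^{n'-1} · 2^r ≤ 2 · m · 2^r`. [folklore] -/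
theorem choose_middle_le_main {n n' t m r : ℕ} (hn : 3 ≤ n) (hnt : n = n' + t) (ht : t ≤ r + 1)
    (hm : 2 ^ (n' - 1) ≤ m) : n.choose (n / 2) ≤ (1 + 1) * (m * 2 ^ r) := by
  have h1 : n.choose (n / 2) ≤ 2 ^ (n - 1) := choose_middle_le_two_pow_pred n (by omega)
  have h2 : 2 ^ (n - 1) ≤ 2 ^ ((n' - 1) + r + 1) := Nat.pow_le_pow_right (by norm_num) (by omega)
  have h3 : 2 ^ ((n' - 1) + r + 1) = (1 + 1) * (2 ^ (n' - 1) * 2 ^ r) := by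
    rw [pow_add, pow_add]; ring
  calc n.choose (n / 2) ≤ 2 ^ ((n' - 1) + r + 1) := h1.trans h2
    _ = (1 + 1) * (2 ^ (n' - 1) * 2 ^ r) := h3
    _ ≤ (1 + 1) * (m * 2 ^ r) := by gcongr

/-- **The numeric rung from the three stubs**: `AffineMultipleCovering = MultipleCovering 1`.  Constant cofactor ⇒
rescale ⇒ the floor `subtorusCovering_proof` BY NAME; linear cofactor ⇒ absorbing sacrifice ⇒ (degree bound
`n + 1 ≤ m` in the degenerate branch) or (terminal `T¹` bound). [cite: LandsbergRessayre2017, Thm. 2.8, Question 2.2] -/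
theorem affineMultipleCovering_of (h₁ : Stmt.stub_cofactorShape) (h₂ : Stmt.stub_absorbingSacrifice)
    (h₃ : Stmt.stub_perInvariantTorusBound) : AffineMultipleCovering := by
  intro n hn m r Λ B q hΛ hq0 hqd hB
  have hm1 : 1 ≤ m := one_le_size_mul (by omega) hB
  rcases h₁ n m r Λ B q (by omega) hΛ hq0 hqd hB with ⟨c, hc, hqc⟩ | hhom
  · -- constant cofactor: rescale inside the gauge group, then the floor on the nose
    have hB₂ : IsEquivariantDetRepr (Subgroup.closure (torusGen n r Λ)) (c • perPoly (Fin n) ℂ) B := by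
      rw [smul_eq_C_mul, mul_comm, ← hqc]; exact hB
    obtain ⟨B', hB'⟩ := exists_rescale hc hB₂ hm1
    have hfloor : n.choose (n / 2) ≤ m * 2 ^ r :=
      subtorusCovering_proof n hn m r Λ B' hΛ (by simpa only [torusGen] using hB')
    calc n.choose (n / 2) ≤ m * 2 ^ r := hfloor
      _ ≤ (1 + 1) * (m * 2 ^ r) := by omega
  · -- linear cofactor
    have hdeg : n + 1 ≤ m := by
      have h1 := totalDegree_le_of_hasDetRepr_holds (k := ℂ) (σ := Fin n × Fin n) ⟨B, hB.1⟩
      have hq1 : q.totalDegree = 1 := hhom.totalDegree hq0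
      have h2 : (perPoly (Fin n) ℂ * q).totalDegree = n + 1 := by
        rw [totalDegree_mul_of_isDomain (perPoly_ne_zero (Fin n) ℂ) hq0,
          totalDegree_perPoly_holds (n := Fin n) (k := ℂ), Fintype.card_fin, hq1]
      rw [h2] at h1
      exact h1
    obtain ⟨n', t, hnt, ht, hcase⟩ := h₂ n m r Λ B q hn hΛ hq0 hhom hB
    rcases hcase with hsmall | ⟨B', hB'⟩
    · exact choose_middle_le_small hn hdeg (by omega)
    · rcases Nat.lt_or_ge n' 3 with hlt | hn'
      · exact choose_middle_le_small hn hdeg (by omega)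
      · exact choose_middle_le_main hn hnt ht (h₃ n' m B' hn' hB')

/-- **The rung (filed declaration `AffineMultipleShadow`) from the three stubs.** [cite: LandsbergRessayre2017, Question 2.2] -/
theorem AffineMultipleShadow_of (h₁ : Stmt.stub_cofactorShape) (h₂ : Stmt.stub_absorbingSacrifice)
    (h₃ : Stmt.stub_perInvariantTorusBound) : AffineMultipleShadow :=
  affineMultipleShadow_of_affineMultipleCovering (affineMultipleCovering_of h₁ h₂ h₃)

/-- The rung, assembled from the registered stubs (sorries live only inside `stub_*`). [cite: LandsbergRessayre2017, Question 2.2] -/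
theorem AffineMultipleShadow_proof : AffineMultipleShadow :=
  AffineMultipleShadow_of stub_cofactorShape stub_absorbingSacrifice stub_perInvariantTorusBound

/-- The line re-proves the floor up to the dial's loss factor `2` (`MultipleCovering 1 ⇒` floor with `2 · m · 2^r`).
[cite: LandsbergRessayre2017, Thm. 2.8] -/
theorem halfFloor_of_stubs (h₁ : Stmt.stub_cofactorShape) (h₂ : Stmt.stub_absorbingSacrifice)
    (h₃ : Stmt.stub_perInvariantTorusBound) :
    ∀ n : ℕ, 3 ≤ n → ∀ (m r : ℕ) (Λ : Fin r → (Fin n ⊕ Fin n) → ℤ)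
      (B : Matrix (Fin m) (Fin m) (MvPolynomial (Fin n × Fin n) ℂ)), Admissible n r Λ →
      IsEquivariantDetRepr (Subgroup.closure (torusGen n r Λ)) (perPoly (Fin n) ℂ) B →
      Nat.choose n (n / 2) ≤ 2 * (m * 2 ^ r) :=
  halfCovering_of_affineMultipleCovering (affineMultipleCovering_of h₁ h₂ h₃)

/-- … and the RELAXED closing of the host route: symmetrisation into an affine multiple + the rung ⇒ the summit.
[cite: LandsbergRessayre2017, Question 2.2] -/
theorem summit_of_stubs (h₀ : OrbitMultipleBound 1) (h₁ : Stmt.stub_cofactorShape)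
    (h₂ : Stmt.stub_absorbingSacrifice) (h₃ : Stmt.stub_perInvariantTorusBound) : _root_.ValiantsHypothesis :=
  closes_affineMultiple h₀ (affineMultipleCovering_of h₁ h₂ h₃)

/-- … or with the host route's ORIGINAL crux `OrbitDimensionBound`. [cite: LandsbergRessayre2017, Question 2.2] -/
theorem summit_of_stubs' (h₀ : Summit.ValiantsHypothesis.ValiantsHypothesis.Theses.FreeSubtorus.OrbitDimensionBound)
    (h₁ : Stmt.stub_cofactorShape) (h₂ : Stmt.stub_absorbingSacrifice) (h₃ : Stmt.stub_perInvariantTorusBound) :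
    _root_.ValiantsHypothesis :=
  closes_of_orbitDimensionBound h₀ (affineMultipleCovering_of h₁ h₂ h₃)

end Summit.ValiantsHypothesis.ValiantsHypothesis.Cruxes.OrbitDimensionBound.Multiple.Line

end
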